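/-
Copyright (c) 2026. All rights reserved.
Released under Apache 2.0 license as described in the file LICENSE.
Authors: abc-iut cell — seat abc-iut-f-099 (F fact-proving wave, tranche 99: FACT-LIST rows F-0125, F-0127).
Proof-only companion to `HolomorphicCores.lean` ([AbsTopIII] Prop 2.5 (d), (e)); no new definitions.
-/
import Literature.AnabelianGeometry.AbsoluteAnabelian.ParallelogramsLocalAddExists
import Literature.AnabelianGeometry.AbsoluteAnabelian.ParallelogramsPlanarRecovered
import Literature.AnabelianGeometry.AbsoluteAnabelian.ParallelogramsPlanarCoorient
import HarnessLib

/-!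
# [AbsTopIII] Prop 2.5 (e) and (d) at the printed input data — the relations `LocalAdd` and
# `StrictlyCoOriented` CHARACTERISED exactly (FACT-LIST F-0125, F-0127; proof-only)

S. Mochizuki, *Topics in absolute anabelian geometry III: global reconstruction algorithms*, J. Math. Sci.
Univ. Tokyo 22 (2015) [MochizukiAbsTopIII2015], Prop. 2.5, kurims manuscript pp. 56–57:

> (d) […] two frames `F = (S₁, S₂)`, `F′ = (S′₁, S′₂)` of `U` at `p` [are] *strictly co-oriented* if `S′₁` is
> framed by `F`, and `S₂` is framed by `F′` […]
> (e) […] Then one constructs the *local additive structure* of `U` at `p`, i.e., the structure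
> `a +_p b = c` (relative to the origin `p`) […] `c ∈ U` to be the unique endpoint of a side of `P` that
> `∉ {a, b, p}`. (Thus, "`a +_p b`" is defined for `a, b` in some neighborhood of `p` in `U`.)

The FACT-LIST rows **F-0125** `Parallelograms.LocalAdd` and **F-0127** `Parallelograms.StrictlyCoOriented`
(`HolomorphicCores.lean`, abc-iut-L4-t14) are RELATIONS produced by the algorithm of Prop. 2.5 on abstract
data `(U, 𝒬)`; their universal closures are refuted and model instances landed
(`ParallelogramsRelationsClosureRefuted.lean`, gen 0 of this seat; `ParallelogramsLocalAddExists.lean`,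
`ParallelogramsPlanarCoorient.lean`, `ParallelogramsPlanarFrames.lean`).  This companion completes the
instance forms to EXACT CHARACTERISATIONS at the printed input data `U ⊆ ℂ` open, `𝒮(U) ⊆ 𝒬 ⊆ 𝒫(U)`
(the Prop 2.5 (c) reconstruction `parallelograms 𝒬 = 𝒫(U)` being the landed
`Parallelograms.parallelograms_eq_of_subset`, no such hypothesis remains):

* `Parallelograms.LocalAdd.closure_subset` — the new half: if `a +_p b = c` with `a, b ≠ p`, then the CLOSED
  parallelogram `p + [0,1](a − p) + [0,1](b − p)` lies in `U` (the witnessing `P ∈ 𝒫(U)` has corner `p`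
  and adjacent corners `a`, `b`);
* `Parallelograms.localAdd_iff` — **Prop 2.5 (e) is exactly Euclidean addition relative to `p` on its
  natural domain**: `LocalAdd 𝒬 p a b c ↔ (a = p ∧ c = b) ∨ (b = p ∧ c = a) ∨ (a − p, b − p independent ∧
  p + [0,1](a−p) + [0,1](b−p) ⊆ U ∧ c = a + b − p)`; `localAdd_squares_iff` is the case `𝒬 = 𝒮(U)`;
* `Parallelograms.strictlyCoOriented_iff_exists_pos_coeffs` — **Prop 2.5 (d) at corner data**: the frames
  `([p, p+e₁], [p, p+e₂])` of `p + (0,1)e₁ + (0,1)e₂` and `([p, p+f₁], [p, p+f₂])` of `p + (0,1)f₁ + (0,1)f₂`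
  (closures in `U`) are strictly co-oriented **iff** `f₁ = α e₁ + β e₂` and `e₂ = γ f₁ + δ f₂` with
  `α, β, γ, δ > 0` (assembling the landed `exists_pos_coeffs_of_segment_meets` and
  `strictlyCoOriented_of_pos_coeffs`; every frame at `p` has such corner data, `IsFrameOf.exists_vectors`).

Refereed pre-IUT material, elementary plane geometry; nothing here bears on the disputed [IUTchIII]
Cor. 3.12 or takes a side; a FACT row is an assumption label, and this file only decides its instances.
-/

namespace Literature.AnabelianGeometry.AbsoluteAnabelian

open _root_.Complex _root_.Set

noncomputable section

/-- Convex-coordinate bookkeeping on the unit square: for corner coordinates `x₀, x₁ ∈ {0, 1}` and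
`s ∈ [0, 1]`, `x₀ + s (x₁ − x₀) ∈ [0, 1]`. (Auxiliary.) [cite: MochizukiAbsTopIII2015, Proposition 2.5 (proof) pp.55–57] -/
theorem corner_convexCoord_mem {x₀ x₁ s : ℝ} (h₀ : x₀ = 0 ∨ x₀ = 1) (h₁ : x₁ = 0 ∨ x₁ = 1) (hs : 0 ≤ s)
    (hs' : s ≤ 1) : 0 ≤ x₀ + s * (x₁ - x₀) ∧ x₀ + s * (x₁ - x₀) ≤ 1 := by
  rcases h₀ with rfl | rfl <;> rcases h₁ with rfl | rfl <;> constructor <;> nlinarith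

section Planar

variable {U : Set ℂ}

/-! ### Prop 2.5 (e): the local additive structure is Euclidean addition on its natural domain -/

/-- **[AbsTopIII] Prop 2.5 (e), the domain of `+_p`.** For `U ⊆ ℂ` open, `𝒮(U) ⊆ 𝒬 ⊆ 𝒫(U)`: if
`a +_p b = c` in the sense of `Parallelograms.LocalAdd` with `a, b ≠ p`, then the closed parallelogram
`p + [0,1](a − p) + [0,1](b − p)` lies in `U` — the witnessing parallelogram `P ∈ 𝒫(U)` (with sides
`S_a ∋ a`, `S_b ∋ b` through `p`, `∂S_a = {p, a}`, `∂S_b = {p, b}`) has corner `p` and ADJACENT corners `a`, `b`,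
so this closed parallelogram is `P̄ ⊆ U`. [cite: MochizukiAbsTopIII2015, Proposition 2.5 (e) p.57] -/
theorem Parallelograms.LocalAdd.closure_subset (hU : IsOpen U) {𝒬 : Set (Set U)}
    (h𝒬 : ∀ Q ∈ 𝒬, Subtype.val '' Q ∈ parallelogramsIn U)
    (h𝒮 : ∀ Q : Set U, Subtype.val '' Q ∈ squaresIn U → Q ∈ 𝒬) {p a b c : U} (ha : a ≠ p) (hb : b ≠ p)
    (h : Parallelograms.LocalAdd 𝒬 p a b c) :
    closure (openParallelogram (p : ℂ) (a - p) (b - p)) ⊆ U := by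
  have H := Parallelograms.parallelograms_eq_of_subset hU h𝒬 h𝒮
  have hind := (Parallelograms.coe_eq_of_localAdd hU h𝒬 h𝒮 H ha hb h).2
  rcases h with ⟨hap, -⟩ | ⟨hbp, -⟩ | ⟨-, -, P, hP, Sa, Sb, hSa, hSb, -, hea, heb, -, -, -⟩
  · exact (ha hap).elim
  · exact (hb hbp).elim
  obtain ⟨h𝒬', -⟩ := Parallelograms.hyps_of_parallelograms_eq H
  obtain ⟨z, v, w, hvw, hPe, hcl⟩ := h𝒬' P hP
  rw [hPe] at hcl
  obtain ⟨A, hA⟩ := exists_homeomorph_frame z v w hvw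
  obtain ⟨x₀, y₀, x₁, y₁, hx₀, hy₀, hx₁, hy₁, hne₁, hsh₁, hp₀, ha₁, -⟩ :=
    Parallelograms.exists_corners_of_isSide hU h𝒬 h𝒮 H hP hPe hvw hcl hA hSa hea
  obtain ⟨x₀', y₀', x₂, y₂, -, -, hx₂, hy₂, hne₂, hsh₂, hp₀', hb₂, -⟩ :=
    Parallelograms.exists_corners_of_isSide hU h𝒬 h𝒮 H hP hPe hvw hcl hA hSb heb
  obtain ⟨rfl, rfl⟩ : x₀ = x₀' ∧ y₀ = y₀' := frame_mk_inj hvw hA (hp₀.symm.trans hp₀')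
  rw [frame_apply_mk hA] at hp₀ ha₁ hb₂
  -- two edges through `p` along the SAME edge direction would make `a − p`, `b − p` dependent
  have hdep : ∀ {ξ η : ℝ} (e : ℂ), (a : ℂ) - p = (ξ : ℂ) * e → (b : ℂ) - p = (η : ℂ) * e → ξ = 0 := by
    intro ξ η e hae hbe
    have h0 : η • ((a : ℂ) - p) + (-ξ) • ((b : ℂ) - p) = 0 := by
      rw [Complex.real_smul, Complex.real_smul, hae, hbe]; push_cast; ring
    have := (LinearIndependent.pair_iff.1 hind) η (-ξ) h0
    exact neg_eq_zero.mp this.2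
  intro x hx
  obtain ⟨s, t, hs, hs1, ht, ht1, rfl⟩ := (mem_closure_openParallelogram_iff hind).1 hx
  apply hcl
  rw [mem_closure_openParallelogram_iff hvw]
  rcases hsh₁ with hxx₁ | hyy₁ <;> rcases hsh₂ with hxx₂ | hyy₂
  · -- both `a` and `b` on the vertical edge through `p`: impossible
    exfalso
    have hξ : y₁ - y₀ = 0 := hdep (η := y₂ - y₀) w (by rw [ha₁, hp₀, hxx₁]; push_cast; ring)
      (by rw [hb₂, hp₀, hxx₂]; push_cast; ring)
    exact hne₁ ⟨hxx₁, by linarith⟩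
  · -- `a` vertical (`a − p = (y₁ − y₀) w`), `b` horizontal (`b − p = (x₂ − x₀) v`)
    refine ⟨x₀ + t * (x₂ - x₀), y₀ + s * (y₁ - y₀), (corner_convexCoord_mem hx₀ hx₂ ht ht1).1,
      (corner_convexCoord_mem hx₀ hx₂ ht ht1).2, (corner_convexCoord_mem hy₀ hy₁ hs hs1).1,
      (corner_convexCoord_mem hy₀ hy₁ hs hs1).2, ?_⟩
    rw [ha₁, hb₂, hp₀, hxx₁, hyy₂]; push_cast; ring
  · -- `a` horizontal, `b` vertical
    refine ⟨x₀ + s * (x₁ - x₀), y₀ + t * (y₂ - y₀), (corner_convexCoord_mem hx₀ hx₁ hs hs1).1,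
      (corner_convexCoord_mem hx₀ hx₁ hs hs1).2, (corner_convexCoord_mem hy₀ hy₂ ht ht1).1,
      (corner_convexCoord_mem hy₀ hy₂ ht ht1).2, ?_⟩
    rw [ha₁, hb₂, hp₀, hyy₁, hxx₂]; push_cast; ring
  · -- both on the horizontal edge through `p`: impossible
    exfalso
    have hξ : x₁ - x₀ = 0 := hdep (η := x₂ - x₀) v (by rw [ha₁, hp₀, hyy₁]; push_cast; ring)
      (by rw [hb₂, hp₀, hyy₂]; push_cast; ring)
    exact hne₁ ⟨by linarith, hyy₁⟩

/-- **[AbsTopIII] Prop 2.5 (e) IS Euclidean addition relative to `p`, exactly.** For `U ⊆ ℂ` open and any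
`𝒮(U) ⊆ 𝒬 ⊆ 𝒫(U)`: `a +_p b = c` in the sense of the `(U, 𝒬(U))`-algorithm (`Parallelograms.LocalAdd`)
**iff** `a = p` and `c = b`, or `b = p` and `c = a`, or `a − p`, `b − p` are `ℝ`-independent, the closed
parallelogram `p + [0,1](a − p) + [0,1](b − p)` lies in `U`, and `c = a + b − p`.  ("Thus, '`a +_p b`' is
defined for `a, b` in some neighborhood of `p` in `U`" — here with the exact domain.)
[cite: MochizukiAbsTopIII2015, Proposition 2.5 (e) p.57] -/
theorem Parallelograms.localAdd_iff (hU : IsOpen U) {𝒬 : Set (Set U)}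
    (h𝒬 : ∀ Q ∈ 𝒬, Subtype.val '' Q ∈ parallelogramsIn U)
    (h𝒮 : ∀ Q : Set U, Subtype.val '' Q ∈ squaresIn U → Q ∈ 𝒬) {p a b c : U} :
    Parallelograms.LocalAdd 𝒬 p a b c ↔
      (a = p ∧ c = b) ∨ (b = p ∧ c = a) ∨
      (LinearIndependent ℝ ![(a : ℂ) - p, (b : ℂ) - p] ∧
        closure (openParallelogram (p : ℂ) (a - p) (b - p)) ⊆ U ∧ (c : ℂ) = a + b - p) := by
  have H := Parallelograms.parallelograms_eq_of_subset hU h𝒬 h𝒮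
  constructor
  · intro h
    by_cases ha : a = p
    · subst ha
      exact Or.inl ⟨rfl, (Parallelograms.localAdd_pt_left_iff _ _ _).1 h⟩
    by_cases hb : b = p
    · subst hb
      exact Or.inr (Or.inl ⟨rfl, (Parallelograms.localAdd_pt_right_iff _ _ _).1 h⟩)
    have h1 := Parallelograms.coe_eq_of_localAdd hU h𝒬 h𝒮 H ha hb h
    exact Or.inr (Or.inr ⟨h1.2, Parallelograms.LocalAdd.closure_subset hU h𝒬 h𝒮 ha hb h, h1.1⟩)
  · rintro (⟨rfl, rfl⟩ | ⟨rfl, rfl⟩ | ⟨hind, hcl, hc⟩)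
    · exact (Parallelograms.localAdd_pt_left_iff _ _ _).2 rfl
    · exact (Parallelograms.localAdd_pt_right_iff _ _ _).2 rfl
    · exact Parallelograms.localAdd_of_linearIndependent hU h𝒬 h𝒮 H hind hcl hc

/-- **[AbsTopIII] Prop 2.5 (e) for the printed input data `(U, 𝒮(U))`** — the local additive structure
computed from the pre-compact squares alone is Euclidean addition relative to `p` on the exact domain
`{(a, b) : p + [0,1](a−p) + [0,1](b−p) ⊆ U}` (plus the origin cases).
[cite: MochizukiAbsTopIII2015, Proposition 2.5 (e) p.57] -/
theorem Parallelograms.localAdd_squares_iff (hU : IsOpen U) {p a b c : U} :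
    Parallelograms.LocalAdd {Q : Set U | Subtype.val '' Q ∈ squaresIn U} p a b c ↔
      (a = p ∧ c = b) ∨ (b = p ∧ c = a) ∨
      (LinearIndependent ℝ ![(a : ℂ) - p, (b : ℂ) - p] ∧
        closure (openParallelogram (p : ℂ) (a - p) (b - p)) ⊆ U ∧ (c : ℂ) = a + b - p) :=
  Parallelograms.localAdd_iff hU (fun _ hQ => squaresIn_subset_parallelogramsIn U hQ) (fun _ h => h)

/-! ### Prop 2.5 (d): strict co-orientation at corner data is the positive-coefficients condition -/

/-- **[AbsTopIII] Prop 2.5 (d), necessity.** If the corner frames `([p, p+e₁], [p, p+e₂])` of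
`P = p + (0,1)e₁ + (0,1)e₂` and `([p, p+f₁], [p, p+f₂])` of `P' = p + (0,1)f₁ + (0,1)f₂` (`e`, `f` independent
pairs) are strictly co-oriented, then `f₁ = α e₁ + β e₂` and `e₂ = γ f₁ + δ f₂` with `α, β, γ, δ > 0`
("`S'₁` is framed by `F`, and `S₂` is framed by `F'`" forces the two segments into the open cones).
[cite: MochizukiAbsTopIII2015, Proposition 2.5 (d) p.56] -/
theorem Parallelograms.StrictlyCoOriented.exists_pos_coeffs {𝒬 : Set (Set U)} {p : U}
    {e₁ e₂ f₁ f₂ : ℂ} (he : LinearIndependent ℝ ![e₁, e₂]) (hf : LinearIndependent ℝ ![f₁, f₂])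
    (hco : Parallelograms.StrictlyCoOriented 𝒬 (Subtype.val ⁻¹' openParallelogram (p : ℂ) e₁ e₂)
      (Subtype.val ⁻¹' segment ℝ (p : ℂ) (p + e₁), Subtype.val ⁻¹' segment ℝ (p : ℂ) (p + e₂))
      (Subtype.val ⁻¹' openParallelogram (p : ℂ) f₁ f₂)
      (Subtype.val ⁻¹' segment ℝ (p : ℂ) (p + f₁), Subtype.val ⁻¹' segment ℝ (p : ℂ) (p + f₂))) :
    ∃ α β γ δ : ℝ, 0 < α ∧ 0 < β ∧ 0 < γ ∧ 0 < δ ∧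
      f₁ = (α : ℂ) * e₁ + (β : ℂ) * e₂ ∧ e₂ = (γ : ℂ) * f₁ + (δ : ℂ) * f₂ := by
  obtain ⟨⟨-, hinf₁⟩, ⟨-, hinf₂⟩⟩ := hco
  obtain ⟨x, hx⟩ := hinf₁.nonempty
  obtain ⟨y, hy⟩ := hinf₂.nonempty
  obtain ⟨α, β, hα, hβ, h1⟩ := exists_pos_coeffs_of_segment_meets he ⟨(x : ℂ), hx⟩
  obtain ⟨γ, δ, hγ, hδ, h2⟩ := exists_pos_coeffs_of_segment_meets hf ⟨(y : ℂ), hy⟩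
  exact ⟨α, β, γ, δ, hα, hβ, hγ, hδ, h1, h2⟩

/-- **[AbsTopIII] Prop 2.5 (d) at corner data — strict co-orientation characterised.** For `U ⊆ ℂ` open,
`𝒮(U) ⊆ 𝒬 ⊆ 𝒫(U)`, and two non-degenerate corner frames at `p` with closures in `U`: the frames
`([p, p+e₁], [p, p+e₂])` (parallelogram `p + (0,1)e₁ + (0,1)e₂`) and `([p, p+f₁], [p, p+f₂])` (parallelogram
`p + (0,1)f₁ + (0,1)f₂`) are STRICTLY CO-ORIENTED **iff** `f₁ = α e₁ + β e₂` and `e₂ = γ f₁ + δ f₂` for some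
`α, β, γ, δ > 0`.  (Every frame of `(U, 𝒬)` at `p` has such corner data: `IsFrameOf.exists_vectors`.)
[cite: MochizukiAbsTopIII2015, Proposition 2.5 (d) p.56] -/
theorem Parallelograms.strictlyCoOriented_iff_exists_pos_coeffs (hU : IsOpen U) {𝒬 : Set (Set U)}
    (h𝒬 : ∀ Q ∈ 𝒬, Subtype.val '' Q ∈ parallelogramsIn U)
    (h𝒮 : ∀ Q : Set U, Subtype.val '' Q ∈ squaresIn U → Q ∈ 𝒬) {p : U} {e₁ e₂ f₁ f₂ : ℂ}
    (he : LinearIndependent ℝ ![e₁, e₂]) (hf : LinearIndependent ℝ ![f₁, f₂])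
    (hce : closure (openParallelogram (p : ℂ) e₁ e₂) ⊆ U)
    (hcf : closure (openParallelogram (p : ℂ) f₁ f₂) ⊆ U) :
    Parallelograms.StrictlyCoOriented 𝒬 (Subtype.val ⁻¹' openParallelogram (p : ℂ) e₁ e₂)
        (Subtype.val ⁻¹' segment ℝ (p : ℂ) (p + e₁), Subtype.val ⁻¹' segment ℝ (p : ℂ) (p + e₂))
        (Subtype.val ⁻¹' openParallelogram (p : ℂ) f₁ f₂)
        (Subtype.val ⁻¹' segment ℝ (p : ℂ) (p + f₁), Subtype.val ⁻¹' segment ℝ (p : ℂ) (p + f₂)) ↔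
      ∃ α β γ δ : ℝ, 0 < α ∧ 0 < β ∧ 0 < γ ∧ 0 < δ ∧
        f₁ = (α : ℂ) * e₁ + (β : ℂ) * e₂ ∧ e₂ = (γ : ℂ) * f₁ + (δ : ℂ) * f₂ := by
  refine ⟨Parallelograms.StrictlyCoOriented.exists_pos_coeffs he hf, ?_⟩
  rintro ⟨α, β, γ, δ, hα, hβ, hγ, hδ, h1, h2⟩
  exact Parallelograms.strictlyCoOriented_of_pos_coeffs hU h𝒬 h𝒮 he hf hce hcf hα hβ hγ hδ h1 h2

end Planar

end

end Literature.AnabelianGeometry.AbsoluteAnabelian
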